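import Summits.QuantumFields.YangMills.Theorems.AllWindowsColdBoxBoxHighLineStep2Wick
import Summits.QuantumFields.YangMills.Theorems.AllWindowsColdBoxBoxHighLineHodgePoincareStub

/-!
# T-S5.7e `quadFormSplit : QuadFormSplit` BY NAME — the Hodge form of the edge chart IS the linearised Wilson action plus the linearised
# gauge-fixing term (STUB-PLAN-S5-STEP2 §3/§8, task file ✓`…Theorems.AllWindowsColdBoxBoxHighLineStep2Wick`; LINE-19 S5 ⟨stmt-QuantumFields-24004⟩/⟨24335⟩)

Width seat `ym-line-sfw-p2-w3` (g40, cell `ym-idea-1`), routed by planner ym-idea-2 g18 (2026-08-29T19:07:07Z «w3: T-S5.7b/7e»).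

**Theorem (`quadFormSplit`).**  For every `H ≥ 1` and every edge field `a : LandauFree H → ℝ³`,
`Σ_{p touching the box} |ℓ_p(a)|² + Σ_{x interior} |(d*a)_x|² = boxQuadForm H a` and `ℓ_p^c(a) = (a_{(x,μ)} + a_{(x+e_μ,ν)} − a_{(x+e_ν,μ)} − a_{(x,ν)})^c`
for `p = (x, μ, ν)` — i.e. the precision `hodgeQ H = Qmat + Σ_x g_x g_xᵀ` of the STEP-2 Gaussian, summed over the three colours, splits as the
quadratic (Gaussian) part of the Wilson action over the plaquettes touching the box plus the quadratic part of the gauge-fixing functional `Φ`.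

Proof.  Per colour `v = a^c`: `v·Qmat·v = Σ_{p ∈ plaquettesIn [0,2H+3)⁴, shifted by dirCorner} (landauCoeff_p · v)²` (✓`dotProduct_Qmat_mulVec`,
✓`formM_zero_eq`); the shifted plaquette set (all four corners in `[−1, 2H+1]⁴`, `μ < ν`, ✓`mem_image_shift_iff`) CONTAINS the image of
`plaquettesTouching (boxEdges 4 (2H+1))` under `(x, ⟨(μ,ν), _⟩) ↦ (x, μ, ν)` (a plaquette with a box edge has all corners in `[−1, 2H+1]⁴`), and on the
difference `landauCoeff_p = 0` on the free (= box) edges (✓`coeffAux_eq_zero`), so the two sums agree (`sum_shift_eq_sum_touching`); the gauge part is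
`Σ_x (g_x · v)²` termwise; summing over colours and swapping the sums gives the first clause.  The second clause is ✓`sCirc_glue` with zero pinned data:
the zero extension `glue 0 (a^c)` of the colour component is the colour component of the chart field `freeVec H a` (`glue_colour_eq_freeVec`).

Everything proved, Mathlib + tree only, standard axioms; no definitions.
HONEST LABEL: an S-sized brick of STEP 2 of the XL stub S5 (`stub_landauSecondOrder`) of a critic-PASSed DRAFT line; S5, U5, ⟨24004⟩ ⟨24335⟩ ⟨24336⟩
remain OPEN; no stub is closed by name, no crux, rung or summit is proved; **the Yang–Mills mass gap is NOT proved by this file.**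
-/

set_option autoImplicit false

noncomputable section

open MeasureTheory Matrix Finset Real
open Literature.Probability.LatticeModels (Site mem_halfOpenBox halfOpenBox)
open Literature.MathematicalPhysics.QuantumFieldTheory (Plaq plaquettesIn)
open Literature.MathematicalPhysics.QuantumFieldTheory.LatticeMaxwell
open Literature.MathematicalPhysics.QuantumFieldTheory.AxialGauge (boxEdges mem_boxEdges_iff)
open Literature.MathematicalPhysics.QuantumLattice (ZdEdge ZdPlaquette LGConfig plaquettesTouching plaquetteEdges
  mem_plaquettesTouching_iff)
open Summit.QuantumFields.YangMills.Theorems.WeakCouplingRates (dirCorner)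

namespace Summit.QuantumFields.YangMills.Theorems.AllWindowsColdBoxBoxHighLine

/-! ## Proof -/

namespace QuadSplit

/-- The label map `(x, ⟨(μ, ν), _⟩) ↦ (x, μ, ν)` from genuine plaquettes to plaquette labels is injective. -/
theorem label_injective :
    Function.Injective (fun p : ZdPlaquette 4 => ((p.1, p.2.1.1, p.2.1.2) : Plaq 4)) := by
  rintro ⟨x, ⟨⟨μ, ν⟩, h⟩⟩ ⟨x', ⟨⟨μ', ν'⟩, h'⟩⟩ hpq
  simp only [Prod.mk.injEq] at hpq
  obtain ⟨rfl, rfl, rfl⟩ := hpq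
  rfl

/-- Coordinates of `Pi.single i 1`. -/
theorem single_apply (i k : Fin 4) : (Pi.single i (1 : ℤ) : Fin 4 → ℤ) k = if k = i then 1 else 0 := by
  by_cases h : k = i
  · subst h; simp
  · simp [h]

/-- A plaquette one of whose edges is a box edge lies in the translated plaquette set of the enlarged block. -/
theorem label_mem_image_shift (H : ℕ) (p : ZdPlaquette 4)
    (hp : p ∈ plaquettesTouching (boxEdges 4 (2 * H + 1))) :
    ((p.1, p.2.1.1, p.2.1.2) : Plaq 4) ∈ (plaquettesIn (halfOpenBox 4 (2 * H + 3))).image (Plaq.shift dirCorner) := by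
  rw [mem_image_shift_iff]
  obtain ⟨e, he⟩ := mem_plaquettesTouching_iff.1 hp
  rw [Finset.mem_inter] at he
  obtain ⟨he1, he2⟩ := he
  have hlt : p.2.1.1 < p.2.1.2 := p.2.2
  have hne : p.2.1.2 ≠ p.2.1.1 := fun h => by rw [h] at hlt; exact lt_irrefl _ hlt
  refine ⟨hlt, ?_⟩
  simp only [plaquetteEdges, Finset.mem_insert, Finset.mem_singleton] at he1
  rcases he1 with rfl | rfl | rfl | rfl
  all_goals
    rw [mem_boxEdges_iff] at he2
    obtain ⟨hb1, hb2⟩ := he2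
    push_cast at hb1 hb2
    try simp only [Pi.add_apply, single_apply] at hb1 hb2
    refine ⟨fun k => ?_, fun k => ?_⟩
    all_goals
      have a1 := hb1 k
      try simp only [Pi.add_apply, single_apply]
      omega

/-- On a free edge the Landau coefficient of a plaquette NOT touching the box vanishes. -/
theorem landauCoeff_eq_zero_of_not_touching (H : ℕ) (q : Plaq 4) (hlt : q.2.1 < q.2.2)
    (hq : (⟨q.1, ⟨(q.2.1, q.2.2), hlt⟩⟩ : ZdPlaquette 4) ∉ plaquettesTouching (boxEdges 4 (2 * H + 1))) :
    landauCoeff H q = 0 := by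
  funext e
  rw [mem_plaquettesTouching_iff, Finset.not_nonempty_iff_eq_empty] at hq
  have hmem : e.1.1 ∈ boxEdges 4 (2 * H + 1) := not_not.1 e.2
  simp only [landauCoeff, coeff, Pi.zero_apply]
  apply coeffAux_eq_zero
  intro hor
  have : e.1.1 ∈ plaquetteEdges (⟨q.1, ⟨(q.2.1, q.2.2), hlt⟩⟩ : ZdPlaquette 4) ∩ boxEdges 4 (2 * H + 1) := by
    rw [Finset.mem_inter]
    refine ⟨?_, hmem⟩
    simp only [plaquetteEdges, Finset.mem_insert, Finset.mem_singleton]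
    rcases hor with h | h | h | h <;> simp [← h]
  rw [hq] at this
  exact absurd this (Finset.notMem_empty _)

/-- **Re-indexing the plaquette energy**: the translated plaquette sum of the enlarged block equals the sum over the plaquettes
touching the box, for any summand vanishing on the genuine plaquettes that do not touch the box. -/
theorem sum_shift_eq_sum_touching (H : ℕ) (f : Plaq 4 → ℝ)
    (hf : ∀ q : Plaq 4, ∀ hlt : q.2.1 < q.2.2,
      (⟨q.1, ⟨(q.2.1, q.2.2), hlt⟩⟩ : ZdPlaquette 4) ∉ plaquettesTouching (boxEdges 4 (2 * H + 1)) → f q = 0) :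
    ∑ p ∈ plaquettesIn (halfOpenBox 4 (2 * H + 3)), f (Plaq.shift dirCorner p) =
      ∑ p ∈ plaquettesTouching (boxEdges 4 (2 * H + 1)), f (p.1, p.2.1.1, p.2.1.2) := by
  rw [← Finset.sum_image (g := Plaq.shift dirCorner) (f := f) fun p _ q _ h => Plaq.shift_injective _ h,
    ← Finset.sum_image (g := fun p : ZdPlaquette 4 => ((p.1, p.2.1.1, p.2.1.2) : Plaq 4)) (f := f)
      fun p _ q _ h => label_injective h]
  symm
  apply Finset.sum_subset
  · intro q hq
    obtain ⟨p, hp, rfl⟩ := Finset.mem_image.1 hq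
    exact label_mem_image_shift H p hp
  · intro q hqin hqnot
    have hlt : q.2.1 < q.2.2 := ((mem_image_shift_iff H q).1 hqin).1
    apply hf q hlt
    intro hmem
    apply hqnot
    exact Finset.mem_image.2 ⟨_, hmem, rfl⟩

/-- The gauge part of the Hodge form: `v · (Σ_x g_x g_xᵀ) v = Σ_x (g_x · v)²`. -/
theorem dotProduct_sum_vecMulVec_mulVec (H : ℕ) (v : LandauFree H → ℝ) :
    v ⬝ᵥ ((∑ x ∈ interiorSites H, vecMulVec (gradVec H x) (gradVec H x)) *ᵥ v) =
      ∑ x ∈ interiorSites H, (gradVec H x ⬝ᵥ v) ^ 2 := by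
  rw [Matrix.sum_mulVec, dotProduct_sum]
  refine Finset.sum_congr rfl fun x _ => ?_
  have h1 : vecMulVec (gradVec H x) (gradVec H x) *ᵥ v = (gradVec H x ⬝ᵥ v) • gradVec H x := by
    ext e
    simp only [Matrix.mulVec, vecMulVec_apply, dotProduct, Pi.smul_apply, smul_eq_mul, Finset.sum_mul]
    exact Finset.sum_congr rfl fun e' _ => by ring
  rw [h1, dotProduct_smul, smul_eq_mul, dotProduct_comm v (gradVec H x), sq]

/-- **The Hodge form as the plaquette energy over the plaquettes touching the box plus the interior divergence energy.** -/
theorem dotProduct_hodgeQ_eq_sum_touching (H : ℕ) (v : LandauFree H → ℝ) :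
    v ⬝ᵥ (hodgeQ H *ᵥ v) =
      (∑ p ∈ plaquettesTouching (boxEdges 4 (2 * H + 1)), (landauCoeff H (p.1, p.2.1.1, p.2.1.2) ⬝ᵥ v) ^ 2) +
        ∑ x ∈ interiorSites H, (gradVec H x ⬝ᵥ v) ^ 2 := by
  rw [hodgeQ, Matrix.add_mulVec, dotProduct_add, dotProduct_Qmat_mulVec, formM_zero_eq,
    dotProduct_sum_vecMulVec_mulVec]
  congr 1
  refine sum_shift_eq_sum_touching H (fun q => (landauCoeff H q ⬝ᵥ v) ^ 2) fun q hlt hq => ?_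
  simp only [landauCoeff_eq_zero_of_not_touching H q hlt hq, zero_dotProduct, sq, mul_zero]

/-- The zero extension of the colour-`c` component is the colour-`c` component of `freeVec`. -/
theorem glue_colour_eq_freeVec (H : ℕ) (a : LandauFree H → E3) (c : Fin 3) (e : ZdEdge 4) :
    glue (pin := landauPin H) dirCorner (2 * H + 3) 0 (colour a c) e = freeVec H a e c := by
  by_cases h : e ∈ boxEdgesAt dirCorner (2 * H + 3)
  · by_cases h' : e ∈ boxEdges 4 (2 * H + 1)
    · rw [freeVec, dif_pos h, dif_pos h']
      exact glue_apply_free (pin := landauPin H) 0 (colour a c) ⟨⟨e, h⟩, not_not_intro h'⟩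
    · rw [freeVec, dif_pos h, dif_neg h', glue_apply_pin (pin := landauPin H) 0 (colour a c) h h']
      simp
  · rw [freeVec, dif_neg h, glue_apply_of_not_mem (pin := landauPin H) 0 (colour a c) h]
    simp

/-- **The linearised curvature is the signed sum of the four edge variables.** -/
theorem linCurv_eq_plaqLin (H : ℕ) (x : Site 4) (μ ν : Fin 4) (a : LandauFree H → E3) (c : Fin 3) :
    linCurv H (x, μ, ν) a c = plaqLin (plaqVar H x μ ν a) c := by
  have key := sCirc_glue (pin := landauPin H) (a := dirCorner) (n := 2 * H + 3) 0 (colour a c) (x, μ, ν)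
  have hb : bterm (landauPin H) dirCorner (2 * H + 3) 0 (x, μ, ν) = 0 := by
    simp [bterm, sCirc, glue_zero_eq_sum]
  rw [hb, add_zero] at key
  rw [linCurv, landauCoeff, ← key]
  simp only [sCirc, glue_colour_eq_freeVec, plaqLin, plaqVar, plaqEdge]
  simp

end QuadSplit

open QuadSplit in
/-- **T-S5.7e `QuadFormSplit`, BY NAME**: the Hodge form of the chart is the linearised Wilson action (sum over the plaquettes
touching the box of `|ℓ_p|²`) plus the linearised gauge-fixing term, and `ℓ_p` is the signed sum of the four edge variables of `p`. -/
theorem quadFormSplit : QuadFormSplit := by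
  intro H _ a
  refine ⟨?_, fun x μ ν c _ => linCurv_eq_plaqLin H x μ ν a c⟩
  simp only [boxQuadForm, dotProduct_hodgeQ_eq_sum_touching, linCurvSq, linCurv, divLinSq, divLin, Finset.sum_add_distrib]
  rw [Finset.sum_comm]
  congr 1
  exact Finset.sum_comm

end Summit.QuantumFields.YangMills.Theorems.AllWindowsColdBoxBoxHighLine

end
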